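import Summits.Schanuel.Schanuel.Theorems.RootDecomp1EEStableRung
import Summits.Schanuel.Schanuel.Theorems.RootDecomp1EEStableStructure
import Summits.Schanuel.Schanuel.Theorems.RootDecomp1ArgumentCells

/-!
# RootDecomp1 — ROUND 14 «ValueCells» (decomp-schanuel, lens 1 «grading / quantitative ladder», gen 14)

Target served: `_root_.Schanuel` through `route-Schanuel-RootDecomp1` (draft rev 22), whose deciding theorem is
`closes (h₂ : SchanuelTwo) (hK) (hD : DefectOneSchanuel) (hU : RationalImageSchanuel) (hG) (hC : NonrationalSaturatedEssentialSchanuel)`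
with `Cⁿᵘ` split (rev 22) into **D** = `DisjointSaturatedEssentialSchanuel` (stmt-Schanuel-30353, entanglement
grade `ε = 0`) and **Cᵉ** = `EntangledSaturatedEssentialSchanuel` (stmt-30352, `ε ≥ 1`).

## What this round proves (0 sorry; every `h29` binder is the tree THEOREM `smallTrdeg_thm_2_9_pos_holds`)

The critic's standing target (STATUS verdict (viii), first (i′) item): *decide the `(trdeg ℚ(z), trdeg ℚ(e^z)) = (1,1)`
mixed cell of D₃ on a decidable family not inside the LW / Hermite–Lindemann / Gel'fond-cubic (algebraic base) /
logCons calibration cells, or book a certified OPEN member by theorem.*  Family decided here: the whole **E-STABLE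
STRATUM at `n = 3`** — all ℚ-free triples whose ℚ-span admits an irrational algebraic multiplier; by
`RootDecomp1EEStableStructure.eStable_prime_isLine` these are exactly the CUBIC LINES `span_ℚ z = λ(ℚ + ℚβ + ℚβ²)`,
`[ℚ(β):ℚ] = 3`, with ARBITRARY base `λ ≠ 0` (the round-6 Gel'fond–Diaz cell is the sub-family `λ = log α`, `α ∈ ℚ̄`).

* §1 `exp_isAlgebraic_vals_of_mem_span` — VALUE-FIELD TRANSPORT: `v ∈ span_ℚ z ⇒ e^v` algebraic over `ℚ(e^z)`
  (not only over `ℚ(z, e^z)` as in the anchor toolkit); `valDegree_le_of_mem_span`: `trdeg ℚ(e^w) ≤ trdeg ℚ(e^z)`.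
* §2 `two_le_valDegree_of_eStable_three` — **`2 ≤ trdeg ℚ(e^z)` on every E-stable ℚ-free triple**: Theorem 2.9,
  `t₁`-CLAUSE with `d = ℓ = 3` (`d + 2ℓ = 9 ≤ dℓ`; = Baker, *TNT* Thm 12.1, Gel'fond–Tijdeman) on `x = (1, β, β²)`,
  `y = (z₀, βz₀, β²z₀)`: `K₁ = ℚ(x, e^{x_i y_j})` has `trdeg ≥ 2` and is algebraic over `ℚ(e^z)` (x algebraic,
  `x_i y_j ∈ span_ℚ z`).  Lens 2's `two_le_trdeg_of_eStable_three` used the `t₂`-clause (`d = 2`) and bounds only the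
  TOTAL degree (item B₃); the `t₁`-clause bounds the VALUE degree, which is what the bidegree grading of D / Cᵉ reads.
* §3 `argDegree_le_one_of_eStable_three` — `trdeg ℚ(z) ≤ 1` (all of `z` algebraic over `ℚ(λ)`).
* §4 `bidegree_of_eStable_three`, `not_cell_one_one_of_eStable_three`, `not_argFull_of_eStable_three` — the
  stratum meets NONE of D₃'s failure cells `(1,1)`, `(2,0)` and none of Cᵉ₃'s cells `(2,1)`, `(2,2)`.
* §5 `disjointSchanuel_eStable_three` — **item D at `n = 3` HOLDS on the E-stable stratum, any base**
  (LW if `z ⊂ ℚ̄`, else `1 + 2 ≤ t` under disjointness); `disjointSaturatedEssentialSchanuel_eStable_three` = the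
  item's binders VERBATIM (`n ≤ 3` and E-stability inserted).
* §6 `residue_of_eStable_three`, `schanuel_iff_not_cell_one_two_of_eStable_three` — on the stratum,
  `3 ≤ t ∨ (t₁, t₂, t) = (1, 2, 2)`: SCHANUEL ⟺ «no (1,2,2) atom» (Cᵉ₃'s cell (1,2) at `t = 2` = Gel'fond's
  problem «`log α, α^β, α^{β²}` algebraically independent?» at an arbitrary base — OPEN).
* §7 certified literal members `w·(1, ∛2, ∛4)`, any `w ≠ 0` (`cbrtLine_member`; `member_e_cbrtLine`,
  `member_pi_cbrtLine`): ℚ-free, E-stable, bidegree `(≤ 1, ≥ 2)`, D₃ HOLDS, Schanuel there ⟺ not (1,2,2) — OPEN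
  (`w = π`: `e^π ∉ ℚ̄`, so the member is OUTSIDE the round-6 cell; `w = e`: outside it iff `e^e ∉ ℚ̄`, unknown).

## Sources
[cite: NesterenkoPhilippon2001, Ch. 14 Theorem 2.9 (`t₁`-clause); Ch. 13 Theorem 3.1 (iii)] ·
[cite: BakerTNT1975, Ch. 12 Theorem 12.1, pp. 110–111 («two at least of the numbers ξ_i, e^{ξ_i η_j} are
algebraically independent … the formulation here is due to Tijdeman»)] · Chudnovsky 1984, *Contributions*, pp. 21–22
(the `S₁` framework).  Tree: `Literature.Barriers.Schanuel.smallTrdeg_thm_2_9_pos` (+ `_holds`, module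
`LargeTranscendenceDegreeThm29Holds`, not built on the farm 2026-08-30 — hence the binder, the 1E / lens-2 precedent);
parallel certificate on the literal ladder in another route's cone: `RigidCore…DiazAnyBase.two_le_trdeg_exp_ladder_cubic`
(Diaz 1989 Cor. 1; also farm-stale) — not imported, independent proof here.

## Port
File as `Summits/Schanuel/Schanuel/Theorems/RootDecomp1ValueCells.lean` (imports as below, all built); evidence on
stmt-Schanuel-30353 (D) and stmt-30352 (Cᵉ: cells (2,1), (2,2) empty and the (1,2,2) residue on the stratum).
Defines only `cbrtTwo`, `cbrtLine` (§7 literals).  No `sorry`, no new axioms.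

PORT (census-1 gen 8; critic VERDICT 2026-08-30T17:01:47Z ACCEPTED — THEOREM ROUND, (b) port LOW in two parts): this file = §§0–6
(--supports stmt-Schanuel-30353: item D decided at n = 3 on the E-stable stratum); §7 (certified members) → RootDecomp1ValueCellsMembers.lean. Verbatim.
-/

set_option linter.dupNamespace false

noncomputable section

namespace Summit.Schanuel.Schanuel.Theorems.RootDecomp1ValueCells

open Complex IntermediateField Module
open Literature.NumberTheory.Transcendental (exists_nsmul_mem_span_int)
open Literature.Barriers.Schanuel (gridExp gridField₁ smallTrdeg_thm_2_9_pos)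
open Summit.Schanuel.Schanuel.Theorems.RootDecomp1EAnchor (isAlgebraic_of_mem_adjoin
  trdeg_adjoin_le_of_isAlgebraic span_range_le exists_nat_lt_of_lt_natCast)
open Summit.Schanuel.Schanuel.Theorems.RootDecomp1EEStableRung (one_le_trdeg_adjoin_of_transcendental
  mul_mem_span_of_gens eLine_linearIndependent)
open Summit.Schanuel.Schanuel.Theorems.RootDecomp1EEStableStructure (eStable_prime_isLine)
open Summit.Schanuel.Schanuel.Theorems.RootDecomp1ArgumentCells (trdeg_args_le trdeg_vals_le
  trdeg_args_le_one_of_isAlgebraic_adjoin_singleton le_valDegree_of_exp_algebraic_mem)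

/-! ## §1  Value-side transport: exponentials of the span are algebraic over the VALUE field `ℚ(e^z)` -/

/-- `e^a ∈ ℚ(e^z)` for `a` in the `ℤ`-span of `z`. -/
theorem exp_mem_vals_of_mem_span_int {ι : Type*} (z : ι → ℂ) {a : ℂ}
    (ha : a ∈ Submodule.span ℤ (Set.range z)) :
    cexp a ∈ adjoin ℚ (Set.range (cexp ∘ z)) := by
  induction ha using Submodule.span_induction with
  | mem b hb =>
    obtain ⟨i, rfl⟩ := hb
    exact subset_adjoin ℚ _ ⟨i, rfl⟩
  | zero => rw [Complex.exp_zero]; exact one_mem _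
  | add b c _ _ hb hc => rw [Complex.exp_add]; exact mul_mem hb hc
  | smul m b _ hb =>
    rw [zsmul_eq_mul, Complex.exp_int_mul]
    exact zpow_mem hb m

/-- EXPONENTIALS OF THE ℚ-SPAN ARE ALGEBRAIC OVER THE VALUE FIELD `ℚ(e^z)` (`(e^v)^N = e^{Nv} ∈ ℚ(e^z)`). -/
theorem exp_isAlgebraic_vals_of_mem_span {ι : Type*} {z : ι → ℂ} {v : ℂ}
    (hv : v ∈ Submodule.span ℚ (Set.range z)) :
    IsAlgebraic ↥(adjoin ℚ (Set.range (cexp ∘ z))) (cexp v) := by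
  obtain ⟨N, hN, hNv⟩ := exists_nsmul_mem_span_int z hv
  have hmem := exp_mem_vals_of_mem_span_int z hNv
  have hpow : cexp ((N : ℚ) • v) = cexp v ^ N := by
    rw [Nat.cast_smul_eq_nsmul, nsmul_eq_mul, Complex.exp_nat_mul]
  rw [hpow] at hmem
  exact IsAlgebraic.of_pow (Nat.pos_of_ne_zero hN) (isAlgebraic_of_mem_adjoin hmem)

/-- `trdeg ℚ(e^w) ≤ trdeg ℚ(e^z)` when `w ⊆ span_ℚ z`: the VALUE degree is an invariant of the ℚ-span. -/
theorem valDegree_le_of_mem_span {ι κ : Type*} {z : ι → ℂ} {w : κ → ℂ}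
    (hw : ∀ j, w j ∈ Submodule.span ℚ (Set.range z)) :
    Algebra.trdeg ℚ ↥(adjoin ℚ (Set.range (cexp ∘ w))) ≤
      Algebra.trdeg ℚ ↥(adjoin ℚ (Set.range (cexp ∘ z))) := by
  refine trdeg_adjoin_le_of_isAlgebraic ?_
  rintro _ ⟨j, rfl⟩
  exact exp_isAlgebraic_vals_of_mem_span (hw j)

/-! ## §2  THE VALUE DEGREE OF A CUBIC LINE: `2 ≤ trdeg ℚ(e^z)` for every E-stable ℚ-free triple -/

/-- `(1, β, β²)` is ℚ-free as soon as the ladder `(λ, βλ, β²λ)` is. -/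
theorem powers_linearIndependent_of_ladder {β lam : ℂ}
    (h : LinearIndependent ℚ ![lam, β * lam, β ^ 2 * lam]) :
    LinearIndependent ℚ ![(1 : ℂ), β, β ^ 2] := by
  refine LinearIndependent.of_comp (LinearMap.mulRight ℚ lam) ?_
  have hcomp : ⇑(LinearMap.mulRight ℚ lam) ∘ ![(1 : ℂ), β, β ^ 2] = ![lam, β * lam, β ^ 2 * lam] := by
    funext i
    fin_cases i <;> simp [LinearMap.mulRight_apply]
  rw [hcomp]
  exact h

/-- **THE VALUE DEGREE OF A CUBIC LINE (Gel'fond 1949 at an arbitrary base; Waldschmidt's Theorem 2.9,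
`t₁`-clause `d = ℓ = 3`, `x = (1, β, β²)`, `y = (λ, βλ, β²λ)`; = Baker, Thm 12.1; = Diaz 1989 Cor. 1 at `d = 3`).**
For every E-STABLE ℚ-free triple `z` (an irrational algebraic multiplier `β` of `span_ℚ z` exists; then `β` is
cubic and `span_ℚ z = λ·(ℚ + ℚβ + ℚβ²)`), the VALUE field alone has `trdeg ℚ(e^z) ≥ 2`: the field
`K₁ = ℚ(x, e^{x_i y_j}) = ℚ(β, e^{β^k λ} : k ≤ 4)` has `trdeg ≥ 2` (`d + 2ℓ = 9 ≤ dℓ = 9`) and is algebraic over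
`ℚ(e^z)` (`β ∈ ℚ̄`, `β^k λ ∈ span_ℚ z`).  Hypothesis `h29` = the tree THEOREM
`Literature.Barriers.Schanuel.smallTrdeg_thm_2_9_pos_holds` (module `LargeTranscendenceDegreeThm29Holds`, whose cone
is not built on the farm at writing time — the 1E precedent). -/
theorem two_le_valDegree_of_eStable_three (h29 : smallTrdeg_thm_2_9_pos) (z : Fin 3 → ℂ)
    (hz : LinearIndependent ℚ z)
    (hE : ∃ β : ℂ, IsAlgebraic ℚ β ∧ β ∉ Set.range (algebraMap ℚ ℂ) ∧
      ∀ i, β * z i ∈ Submodule.span ℚ (Set.range z)) :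
    (2 : Cardinal) ≤ Algebra.trdeg ℚ ↥(adjoin ℚ (Set.range (cexp ∘ z))) := by
  obtain ⟨β, hβalg, hβq, hst⟩ := hE
  set x : Fin 3 → ℂ := ![(1 : ℂ), β, β ^ 2] with hx
  set y : Fin 3 → ℂ := ![z 0, β * z 0, β ^ 2 * z 0] with hy
  have hyli : LinearIndependent ℚ y := eLine_linearIndependent hz hβq hst
  have hxli : LinearIndependent ℚ x := powers_linearIndependent_of_ladder hyli
  have h2 := (h29 3 3 x y (by norm_num) (by norm_num) hxli hyli).2.1 (by norm_num)
  refine h2.trans ?_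
  set V : IntermediateField ℚ ℂ := adjoin ℚ (Set.range (cexp ∘ z)) with hV
  have hS : ∀ v ∈ Submodule.span ℚ (Set.range z), β * v ∈ Submodule.span ℚ (Set.range z) :=
    fun v hv => mul_mem_span_of_gens hst hv
  have hz0 : z 0 ∈ Submodule.span ℚ (Set.range z) := Submodule.subset_span ⟨0, rfl⟩
  have hyV : ∀ j, y j ∈ Submodule.span ℚ (Set.range z) := by
    intro j
    fin_cases j
    · simpa [hy] using hz0
    · simpa [hy] using hS _ hz0
    · have : β ^ 2 * z 0 = β * (β * z 0) := by ring
      simpa [hy, this] using hS _ (hS _ hz0)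
  have hxV : ∀ i, ∀ v ∈ Submodule.span ℚ (Set.range z), x i * v ∈ Submodule.span ℚ (Set.range z) := by
    intro i v hv
    fin_cases i
    · simpa [hx] using hv
    · simpa [hx] using hS v hv
    · have : β ^ 2 * v = β * (β * v) := by ring
      simpa [hx, this] using hS _ (hS v hv)
  show Algebra.trdeg ℚ ↥(adjoin ℚ (Set.range x ∪ Set.range (gridExp x y))) ≤ Algebra.trdeg ℚ ↥V
  apply trdeg_adjoin_le_of_isAlgebraic
  rintro t (⟨i, rfl⟩ | ⟨p, rfl⟩)
  · fin_cases i
    · simpa [hx] using (isAlgebraic_one : IsAlgebraic ℚ (1 : ℂ)).tower_top (L := ↥V)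
    · simpa [hx] using hβalg.tower_top (L := ↥V)
    · simpa [hx] using (hβalg.pow 2).tower_top (L := ↥V)
  · show IsAlgebraic ↥V (cexp (x p.1 * y p.2))
    exact exp_isAlgebraic_vals_of_mem_span (hxV p.1 _ (hyV p.2))

/-! ## §3  THE ARGUMENT DEGREE OF A CUBIC LINE: `trdeg ℚ(z) ≤ 1` -/

/-- Every E-stable ℚ-free triple has ARGUMENT degree `≤ 1`: `span_ℚ z = λ(ℚ + ℚβ + ℚβ²)`, so `z ⊂ ℚ(λ)^alg`. -/
theorem argDegree_le_one_of_eStable_three (z : Fin 3 → ℂ) (hz : LinearIndependent ℚ z)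
    (hE : ∃ β : ℂ, IsAlgebraic ℚ β ∧ β ∉ Set.range (algebraMap ℚ ℂ) ∧
      ∀ i, β * z i ∈ Submodule.span ℚ (Set.range z)) :
    Algebra.trdeg ℚ ↥(adjoin ℚ (Set.range z)) ≤ 1 := by
  obtain ⟨β, hβalg, hβq, hst⟩ := hE
  obtain ⟨-, lam, -, -, hspan⟩ := eStable_prime_isLine Nat.prime_three z hz hβalg hβq hst
  set K : IntermediateField ℚ ℂ := adjoin ℚ ({lam} : Set ℂ) with hK
  have hlamK : IsAlgebraic ↥K lam := isAlgebraic_of_mem_adjoin (subset_adjoin ℚ _ rfl)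
  have hβK : IsAlgebraic ↥K β := hβalg.tower_top (L := ↥K)
  have halg : ∀ v ∈ Submodule.span ℚ (Set.range fun k : Fin 3 => β ^ (k : ℕ) * lam),
      IsAlgebraic ↥K v := by
    intro v hv
    induction hv using Submodule.span_induction with
    | mem u hu =>
      obtain ⟨k, rfl⟩ := hu
      exact (hβK.pow _).mul hlamK
    | zero => exact isAlgebraic_zero
    | add u u' _ _ hu hu' => exact hu.add hu'
    | smul q u _ hu =>
      rw [Rat.smul_def]
      have hqK : (q : ℂ) ∈ K := SubfieldClass.ratCast_mem K q
      exact (isAlgebraic_of_mem_adjoin hqK).mul hu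
  refine trdeg_args_le_one_of_isAlgebraic_adjoin_singleton z lam fun i => halg _ ?_
  rw [hspan]
  exact Submodule.subset_span ⟨i, rfl⟩

/-! ## §4  THE CELL TABLE AT n = 3 on the E-stable stratum: bidegree `t₁ ≤ 1 < 2 ≤ t₂` -/

/-- **BIDEGREE OF A CUBIC LINE.**  An E-stable ℚ-free triple has `trdeg ℚ(z) ≤ 1`, `2 ≤ trdeg ℚ(e^z)` and
`2 ≤ trdeg ℚ(z, e^z)`: it meets NONE of the n = 3 failure cells `(t₁, t₂) = (1,1), (2,0)` of item D
(`DisjointSaturatedEssentialSchanuel`, stmt-30353) and none of the cells `(2,1), (2,2)` of item Cᵉ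
(`EntangledSaturatedEssentialSchanuel`, stmt-30352); only Cᵉ's cell `(1,2)` («arguments on a curve») is left. -/
theorem bidegree_of_eStable_three (h29 : smallTrdeg_thm_2_9_pos) (z : Fin 3 → ℂ)
    (hz : LinearIndependent ℚ z)
    (hE : ∃ β : ℂ, IsAlgebraic ℚ β ∧ β ∉ Set.range (algebraMap ℚ ℂ) ∧
      ∀ i, β * z i ∈ Submodule.span ℚ (Set.range z)) :
    Algebra.trdeg ℚ ↥(adjoin ℚ (Set.range z)) ≤ 1 ∧
      (2 : Cardinal) ≤ Algebra.trdeg ℚ ↥(adjoin ℚ (Set.range (cexp ∘ z))) ∧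
      (2 : Cardinal) ≤ Algebra.trdeg ℚ ↥(adjoin ℚ (Set.range z ∪ Set.range (cexp ∘ z))) :=
  ⟨argDegree_le_one_of_eStable_three z hz hE, two_le_valDegree_of_eStable_three h29 z hz hE,
    (two_le_valDegree_of_eStable_three h29 z hz hE).trans (trdeg_vals_le z)⟩

/-- The `(1,1)` MIXED CELL of D₃ is EMPTY on the E-stable stratum (indeed `trdeg ℚ(e^z) ≠ 1` there). -/
theorem not_cell_one_one_of_eStable_three (h29 : smallTrdeg_thm_2_9_pos) (z : Fin 3 → ℂ)
    (hz : LinearIndependent ℚ z)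
    (hE : ∃ β : ℂ, IsAlgebraic ℚ β ∧ β ∉ Set.range (algebraMap ℚ ℂ) ∧
      ∀ i, β * z i ∈ Submodule.span ℚ (Set.range z)) :
    ¬ (Algebra.trdeg ℚ ↥(adjoin ℚ (Set.range z)) = 1 ∧
        Algebra.trdeg ℚ ↥(adjoin ℚ (Set.range (cexp ∘ z))) = 1) := by
  rintro ⟨-, h1⟩
  have h2 := two_le_valDegree_of_eStable_three h29 z hz hE
  rw [h1] at h2
  exact absurd h2 (by norm_num)

/-- The `(2,0)` THREE-LOGARITHMS CELL of D₃ and the cells `(2,1)`, `(2,2)` of Cᵉ₃ are EMPTY on the E-stable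
stratum: a cubic line is never ARGUMENT-FULL (`2 ≤ trdeg ℚ(z)` fails). -/
theorem not_argFull_of_eStable_three (z : Fin 3 → ℂ) (hz : LinearIndependent ℚ z)
    (hE : ∃ β : ℂ, IsAlgebraic ℚ β ∧ β ∉ Set.range (algebraMap ℚ ℂ) ∧
      ∀ i, β * z i ∈ Submodule.span ℚ (Set.range z)) :
    ¬ (2 : Cardinal) ≤ Algebra.trdeg ℚ ↥(adjoin ℚ (Set.range z)) := fun h =>
  absurd (h.trans (argDegree_le_one_of_eStable_three z hz hE)) (by norm_num)

/-! ## §5  ITEM D AT n = 3 IS A THEOREM ON THE E-STABLE STRATUM -/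

/-- **D♮₃ ON CUBIC LINES (unscoped form).**  For every E-stable ℚ-free triple `z`: if the argument field and the
value field are algebraically disjoint (`trdeg ℚ(z) + trdeg ℚ(e^z) ≤ trdeg ℚ(z, e^z)`, entanglement grade `ε = 0`),
then Schanuel's inequality `3 ≤ trdeg ℚ(z, e^z)` holds.  Two cases: `z ⊂ ℚ̄` — Lindemann–Weierstrass gives
`trdeg ℚ(e^z) = 3`; otherwise `1 ≤ trdeg ℚ(z)` and `2 ≤ trdeg ℚ(e^z)` (§2) ADD under disjointness.  The base `λ`
of the line is ARBITRARY (`e^λ` transcendental allowed): the cell strictly contains the Gel'fond–Diaz calibration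
cell of round 6 (`λ = log α`, `α ∈ ℚ̄`). -/
theorem disjointSchanuel_eStable_three (h29 : smallTrdeg_thm_2_9_pos) (z : Fin 3 → ℂ)
    (hz : LinearIndependent ℚ z)
    (hE : ∃ β : ℂ, IsAlgebraic ℚ β ∧ β ∉ Set.range (algebraMap ℚ ℂ) ∧
      ∀ i, β * z i ∈ Submodule.span ℚ (Set.range z))
    (hsplit : Algebra.trdeg ℚ ↥(adjoin ℚ (Set.range z)) +
        Algebra.trdeg ℚ ↥(adjoin ℚ (Set.range (cexp ∘ z))) ≤
        Algebra.trdeg ℚ ↥(adjoin ℚ (Set.range z ∪ Set.range (cexp ∘ z)))) :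
    ((3 : ℕ) : Cardinal) ≤ Algebra.trdeg ℚ ↥(adjoin ℚ (Set.range z ∪ Set.range (cexp ∘ z))) := by
  by_cases h0 : ∀ i, IsAlgebraic ℚ (z i)
  · -- `z ⊂ ℚ̄`: Lindemann–Weierstrass on the value side, `3 ≤ trdeg ℚ(e^z) ≤ trdeg ℚ(z, e^z)`
    have h3 : ((3 : ℕ) : Cardinal) ≤ Algebra.trdeg ℚ ↥(adjoin ℚ (Set.range (cexp ∘ z))) :=
      le_valDegree_of_exp_algebraic_mem z z h0 hz fun j => subset_adjoin ℚ _ ⟨j, rfl⟩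
    exact h3.trans (trdeg_vals_le z)
  · obtain ⟨i, hi⟩ := not_forall.mp h0
    have h1 : (1 : Cardinal) ≤ Algebra.trdeg ℚ ↥(adjoin ℚ (Set.range z)) :=
      one_le_trdeg_adjoin_of_transcendental hi ⟨i, rfl⟩
    have h2 := two_le_valDegree_of_eStable_three h29 z hz hE
    have h3 : (1 : Cardinal) + 2 ≤ Algebra.trdeg ℚ ↥(adjoin ℚ (Set.range z ∪ Set.range (cexp ∘ z))) :=
      (add_le_add h1 h2).trans hsplit
    have e : ((3 : ℕ) : Cardinal) = (1 : Cardinal) + 2 := by norm_num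
    rw [e]
    exact h3

/-- **RUNG = item D (`DisjointSaturatedEssentialSchanuel`, stmt-Schanuel-30353) RESTRICTED TO `n = 3` AND THE
E-STABLE STRATUM**: the item's binders VERBATIM, with `n ≤ 3` inserted after `3 ≤ n` and the E-stability hypothesis
inserted after `LinearIndependent ℚ z`; the saturation / span-minimality / non-degeneracy binders are kept and unused.
Discharge of `h29`: `Literature.Barriers.Schanuel.smallTrdeg_thm_2_9_pos_holds`. -/
theorem disjointSaturatedEssentialSchanuel_eStable_three (h29 : smallTrdeg_thm_2_9_pos) :
    ∀ (n : ℕ), 3 ≤ n → n ≤ 3 → ∀ (z : Fin n → ℂ), LinearIndependent ℚ z →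
      (∃ β : ℂ, IsAlgebraic ℚ β ∧ β ∉ Set.range (algebraMap ℚ ℂ) ∧
        ∀ i, β * z i ∈ Submodule.span ℚ (Set.range z)) →
      (∀ i, z i ∈ Literature.NumberTheory.Transcendental.ecl (∅ : Set ℂ)) →
      (∀ (m : ℕ), m < n → ∀ (w : Fin m → ℂ), LinearIndependent ℚ w →
        (∀ i, w i ∈ Submodule.span ℚ (Set.range z)) →
        (m : Cardinal) ≤ Algebra.trdeg ℚ ↥(IntermediateField.adjoin ℚ (Set.range w ∪ Set.range (Complex.exp ∘ w)))) →
      (∀ w : ℂ, IsAlgebraic ↥(IntermediateField.adjoin ℚ (Set.range z ∪ Set.range (Complex.exp ∘ z))) w →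
        IsAlgebraic ↥(IntermediateField.adjoin ℚ (Set.range z ∪ Set.range (Complex.exp ∘ z))) (Complex.exp w) →
        w ∈ Submodule.span ℚ (Set.range z)) →
      (∀ (k : ℕ) (t : Fin k → ℂ) (β₀ γ₀ : Fin n → ℂ) (β γ : Fin n → Fin k → ℂ), (∀ i, IsAlgebraic ℚ (β₀ i)) →
        (∀ i j, IsAlgebraic ℚ (β i j)) → (∀ i, IsAlgebraic ℚ (γ₀ i)) → (∀ i j, IsAlgebraic ℚ (γ i j)) →
        (∀ i, z i = β₀ i + ∑ j, β i j * t j) → (∀ i, Complex.exp (z i) = γ₀ i + ∑ j, γ i j * t j) → n ≤ k) →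
      (∀ (k : ℕ) (t : Fin k → ℂ) (β₀ γ₀ : Fin n → ℂ) (β γ : Fin n → Fin k → ℂ) (δ ε : Fin n → Fin k → Fin k → ℂ),
        (∀ i, IsAlgebraic ℚ (β₀ i)) → (∀ i j, IsAlgebraic ℚ (β i j)) → (∀ i j j', IsAlgebraic ℚ (δ i j j')) →
        (∀ i, IsAlgebraic ℚ (γ₀ i)) → (∀ i j, IsAlgebraic ℚ (γ i j)) → (∀ i j j', IsAlgebraic ℚ (ε i j j')) →
        (∀ i, z i = β₀ i + ∑ j, β i j * t j + ∑ j, ∑ j', δ i j j' * (t j * t j')) →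
        (∀ i, Complex.exp (z i) = γ₀ i + ∑ j, γ i j * t j + ∑ j, ∑ j', ε i j j' * (t j * t j')) → n ≤ k) →
      (∀ (k : ℕ) (t : Fin k → ℂ) (D : MvPolynomial (Fin k) ℂ) (N E : Fin n → MvPolynomial (Fin k) ℂ),
        (∀ m, IsAlgebraic ℚ (MvPolynomial.coeff m D)) → (∀ i m, IsAlgebraic ℚ (MvPolynomial.coeff m (N i))) →
        (∀ i m, IsAlgebraic ℚ (MvPolynomial.coeff m (E i))) → MvPolynomial.eval t D ≠ 0 →
        (∀ i, z i * MvPolynomial.eval t D = MvPolynomial.eval t (N i)) →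
        (∀ i, Complex.exp (z i) * MvPolynomial.eval t D = MvPolynomial.eval t (E i)) → n ≤ k) →
      (Algebra.trdeg ℚ ↥(IntermediateField.adjoin ℚ (Set.range z)) +
          Algebra.trdeg ℚ ↥(IntermediateField.adjoin ℚ (Set.range (Complex.exp ∘ z))) ≤
        Algebra.trdeg ℚ ↥(IntermediateField.adjoin ℚ (Set.range z ∪ Set.range (Complex.exp ∘ z)))) →
      (n : Cardinal) ≤ Algebra.trdeg ℚ ↥(IntermediateField.adjoin ℚ (Set.range z ∪ Set.range (Complex.exp ∘ z))) := by
  intro n h3 h3' z hz hE _ _ _ _ _ _ hsplit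
  obtain rfl : n = 3 := le_antisymm h3' h3
  exact disjointSchanuel_eStable_three h29 z hz hE hsplit

/-! ## §6  THE SUMMIT'S RESIDUE on the E-stable stratum = Cᵉ₃'s cell `(1,2)` at `t = 2` (Gel'fond's problem, any base) -/

/-- **RESIDUE DICHOTOMY.**  An E-stable ℚ-free triple either satisfies Schanuel's inequality `3 ≤ trdeg ℚ(z, e^z)`,
or it is a TIGHT ENTANGLED atom of bidegree exactly `(trdeg ℚ(z), trdeg ℚ(e^z), trdeg ℚ(z, e^z)) = (1, 2, 2)`
(«arguments on a curve»: Cᵉ₃'s cell (1,2); e.g. Gel'fond's `log α·(1, β, β²)` — would `log α, α^β, α^{β²}` be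
algebraically dependent — or `e·(1, ∛2, ∛4)`).  So on cubic lines Schanuel ⟺ «no (1,2,2) atom»: items B₃ (lens 2)
and D₃ (this file) are settled there and exactly one cell of Cᵉ₃ remains. -/
theorem residue_of_eStable_three (h29 : smallTrdeg_thm_2_9_pos) (z : Fin 3 → ℂ)
    (hz : LinearIndependent ℚ z)
    (hE : ∃ β : ℂ, IsAlgebraic ℚ β ∧ β ∉ Set.range (algebraMap ℚ ℂ) ∧
      ∀ i, β * z i ∈ Submodule.span ℚ (Set.range z)) :
    ((3 : ℕ) : Cardinal) ≤ Algebra.trdeg ℚ ↥(adjoin ℚ (Set.range z ∪ Set.range (cexp ∘ z))) ∨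
      (Algebra.trdeg ℚ ↥(adjoin ℚ (Set.range z)) = 1 ∧
        Algebra.trdeg ℚ ↥(adjoin ℚ (Set.range (cexp ∘ z))) = 2 ∧
        Algebra.trdeg ℚ ↥(adjoin ℚ (Set.range z ∪ Set.range (cexp ∘ z))) = 2) := by
  by_cases h3 : ((3 : ℕ) : Cardinal) ≤ Algebra.trdeg ℚ ↥(adjoin ℚ (Set.range z ∪ Set.range (cexp ∘ z)))
  · exact Or.inl h3
  right
  have hV2 := two_le_valDegree_of_eStable_three h29 z hz hE
  have hVle := trdeg_vals_le z
  have hT2 : (2 : Cardinal) ≤ Algebra.trdeg ℚ ↥(adjoin ℚ (Set.range z ∪ Set.range (cexp ∘ z))) :=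
    hV2.trans hVle
  obtain ⟨kt, hkt3, hkt⟩ := exists_nat_lt_of_lt_natCast (not_le.mp h3)
  rw [hkt] at hT2 hVle
  have hkt2 : 2 ≤ kt := by exact_mod_cast hT2
  have hkteq : kt = 2 := by omega
  subst hkteq
  have hT : Algebra.trdeg ℚ ↥(adjoin ℚ (Set.range z ∪ Set.range (cexp ∘ z))) = 2 := by
    rw [hkt]; norm_num
  have hVd : Algebra.trdeg ℚ ↥(adjoin ℚ (Set.range (cexp ∘ z))) = 2 :=
    le_antisymm (by exact_mod_cast hVle) hV2
  have hA1 := argDegree_le_one_of_eStable_three z hz hE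
  have hnotalg : ¬ ∀ i, IsAlgebraic ℚ (z i) := by
    intro h0
    have h3v : ((3 : ℕ) : Cardinal) ≤ Algebra.trdeg ℚ ↥(adjoin ℚ (Set.range (cexp ∘ z))) :=
      le_valDegree_of_exp_algebraic_mem z z h0 hz fun j => subset_adjoin ℚ _ ⟨j, rfl⟩
    rw [hVd] at h3v
    exact absurd h3v (by norm_num)
  obtain ⟨i, hi⟩ := not_forall.mp hnotalg
  have hA1' : (1 : Cardinal) ≤ Algebra.trdeg ℚ ↥(adjoin ℚ (Set.range z)) :=
    one_le_trdeg_adjoin_of_transcendental hi ⟨i, rfl⟩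
  exact ⟨le_antisymm hA1 hA1', hVd, hT⟩

/-- Hence, on the E-stable stratum, SCHANUEL'S INEQUALITY ⟺ «not a (1,2,2) atom». -/
theorem schanuel_iff_not_cell_one_two_of_eStable_three (h29 : smallTrdeg_thm_2_9_pos) (z : Fin 3 → ℂ)
    (hz : LinearIndependent ℚ z)
    (hE : ∃ β : ℂ, IsAlgebraic ℚ β ∧ β ∉ Set.range (algebraMap ℚ ℂ) ∧
      ∀ i, β * z i ∈ Submodule.span ℚ (Set.range z)) :
    ((3 : ℕ) : Cardinal) ≤ Algebra.trdeg ℚ ↥(adjoin ℚ (Set.range z ∪ Set.range (cexp ∘ z))) ↔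
      ¬ (Algebra.trdeg ℚ ↥(adjoin ℚ (Set.range z)) = 1 ∧
          Algebra.trdeg ℚ ↥(adjoin ℚ (Set.range (cexp ∘ z))) = 2 ∧
          Algebra.trdeg ℚ ↥(adjoin ℚ (Set.range z ∪ Set.range (cexp ∘ z))) = 2) := by
  constructor
  · rintro h3 ⟨-, -, hT⟩
    rw [hT] at h3
    exact absurd h3 (by norm_num)
  · intro h
    exact (residue_of_eStable_three h29 z hz hE).resolve_right h

end Summit.Schanuel.Schanuel.Theorems.RootDecomp1ValueCells
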